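import Summits.NavierStokesRegularity.NavierStokesRegularity.Theorems.LerayQuarterDissipationRecurrentReductionD
import HarnessLib

/-!
# Crux `FiniteDissipationLiouville` (stmt-NavierStokesRegularity-22144): a singular
# finite-dissipation profile is uniformly LARGE at every scale (sup-norm non-degeneracy)

Theorems file of route `LerayQuarterDissipation` (seat ns-lqd-p1 g2; `--supports` the crux and its
child stmt-22508). Navier–Stokes regularity is NOT proved by anything here; no summit is.

Companion of the sub-threshold leaf (`…Subthreshold.lean`, p589634, dissipation form). Let `u` be a
member of the stratum `𝒟` (Type-I ancient mild in the KNSS gauge, constant `C`; quarter-rate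
dissipation law, constant `K`) which is SINGULAR at the apex (unbounded on every backward cylinder
at the origin), and let `u_l(s,y) = l u(l²s, l y)` be its scaling orbit. Then:

* `exists_piece_norm_ge_of_singular` — there are a slab piece
  `P_n = [−(n+2), −1/(n+2)] × B̄(0, n+2)` and `δ > 0` such that at EVERY scale `l > 0` some point of
  `P_n` carries `‖u_l‖ ≥ δ`. Proof: otherwise pick scales `l_n` with `sup_{P_n} ‖u_{l_n}‖ < 1/(n+1)`;
  the pieces exhaust the open slab, so the orbit limit along `l_n` (p1 g0's `orbitLimit`, KNSS
  compactness, uniform on pieces) is `≡ 0`; but it is singular at the apex by PERSISTENCE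
  (`RecurrentReductionD.persistent_singularity`) — contradiction;
* `exists_scaleInvariant_amplitude_ge_of_singular` — unwound: there are `N > 1` and `δ > 0` such
  that for every scale `l > 0` some point `(t, x)` of the parabolic annulus
  `{l²/N ≤ −t ≤ N l², ‖x‖ ≤ N l}` has scale-invariant amplitude `√(−t) ‖u(t,x)‖ ≥ δ`.
  In words: the Type-I quantity `√(−t)|u|` of a singular member of `𝒟` never becomes small on a
  whole parabolic annulus, at ANY scale (zooming in or out) — the amplitude twin of
  `…Subthreshold.dissipation_exceeds_on_every_long_window_of_singular`.

References: Koch–Nadirashvili–Seregin–Šverák, Acta Math. 203 (2009) = arXiv:0709.3599, §4, §6;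
Albritton–Barker, arXiv:1811.00502, Prop. 2.3.
-/

noncomputable section

-- the summit and its single sub-problem share the name (CONVENTIONS §1), as in every Theorems file
set_option linter.dupNamespace false

namespace Summit.NavierStokesRegularity.NavierStokesRegularity.Theorems.FiniteDissipationLiouville.Nondegenerate

open MeasureTheory Set Filter Topology Metric Function
open Literature.Analysis Literature.Analysis.FluidPDE
open scoped ENNReal

/-- **Sup-norm non-degeneracy of a singular member of the stratum at every scale.** If `u` is
Type-I ancient mild with the quarter-rate dissipation law and singular at the apex, then for some
slab piece `P_n` and some `δ > 0`, every rescaling `u_l`, `l > 0`, has a point of `P_n` where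
`‖u_l‖ ≥ δ`. -/
theorem exists_piece_norm_ge_of_singular {C K : ℝ}
    {u : ℝ → EuclideanSpace ℝ (Fin 3) → EuclideanSpace ℝ (Fin 3)} (hu : IsTypeIAncientMild C u)
    (hlaw : ∀ s : ℝ, s < 0 → ∫⁻ x, ‖fderiv ℝ (u s) x‖ₑ ^ 2 ≤ ENNReal.ofReal (K / Real.sqrt (-s)))
    (hsing : ∀ r > 0, ∀ M : ℝ, ∃ t ∈ Set.Ioo (-(r ^ 2)) (0 : ℝ),
      ∃ x ∈ Metric.ball (0 : EuclideanSpace ℝ (Fin 3)) r, M < ‖u t x‖) :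
    ∃ (n : ℕ) (δ : ℝ), 0 < δ ∧ ∀ l : ℝ, 0 < l →
      ∃ z ∈ Icc (-((n : ℝ) + 2)) (-(1 / ((n : ℝ) + 2))) ×ˢ
          closedBall (0 : EuclideanSpace ℝ (Fin 3)) ((n : ℝ) + 2),
        δ ≤ ‖nsRescale l u z.1 z.2‖ := by
  by_contra hcon
  push Not at hcon
  -- scales `l n` at which `u_{l n}` is smaller than `1/(n+1)` on the piece `P_n`
  have hsmall : ∀ n : ℕ, ∃ l : ℝ, 0 < l ∧ ∀ z ∈ Icc (-((n : ℝ) + 2)) (-(1 / ((n : ℝ) + 2))) ×ˢ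
      closedBall (0 : EuclideanSpace ℝ (Fin 3)) ((n : ℝ) + 2), ‖nsRescale l u z.1 z.2‖ < 1 / ((n : ℝ) + 1) :=
    fun n => hcon n (1 / ((n : ℝ) + 1)) (by positivity)
  choose l hl hlt using hsmall
  -- orbit limit along these scales
  obtain ⟨ψ, hψ, W, hW, -, hunif, -⟩ := RecurrentReductionD.orbitLimit hu hlaw l hl
  have hψt : Tendsto ψ atTop atTop := hψ.tendsto_atTop
  -- the limit vanishes on every piece, hence on the open slab
  have hW0 : ∀ t < 0, ∀ x, W t x = 0 := by
    intro t ht x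
    obtain ⟨m, hm⟩ := exists_mem_slabPiece (E := EuclideanSpace ℝ (Fin 3)) ht x
    -- along `j`, `u_{l (ψ j)} (t,x) → W t x`, and is eventually `≤ 1/(ψ j + 1) → 0`
    have h1 : Tendsto (fun j => nsRescale (l (ψ j)) u t x) atTop (𝓝 (W t x)) :=
      (hunif m).tendsto_at hm
    have hbound : ∀ᶠ j in atTop, ‖nsRescale (l (ψ j)) u t x‖ ≤ 1 / ((ψ j : ℝ) + 1) := by
      filter_upwards [hψt.eventually (eventually_slabPiece_mem_nhds ht x)] with j hj
      exact (hlt (ψ j) (t, x) (mem_of_mem_nhds hj)).le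
    have hlim : Tendsto (fun j => 1 / ((ψ j : ℝ) + 1)) atTop (𝓝 0) := by
      have hT : Tendsto (fun j => ((ψ j : ℝ) + 1)) atTop atTop :=
        tendsto_atTop_add_const_right atTop (1 : ℝ) (tendsto_natCast_atTop_atTop.comp hψt)
      have h := hT.inv_tendsto_atTop
      refine h.congr fun j => ?_
      simp only [Pi.inv_apply, one_div]
    have h2 : Tendsto (fun j => nsRescale (l (ψ j)) u t x) atTop (𝓝 0) :=
      squeeze_zero_norm' hbound hlim
    exact tendsto_nhds_unique h1 h2
  -- but it is singular by persistence
  have hWsing := RecurrentReductionD.persistent_singularity hu hlaw hsing (fun j => l (ψ j))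
    (fun j => hl _) W hunif
  obtain ⟨t, ht, x, -, hM⟩ := hWsing 1 one_pos 0
  rw [hW0 t ht.2 x, norm_zero] at hM
  exact lt_irrefl 0 hM

/-- **The scale-invariant amplitude of a singular member of the stratum is large somewhere in
every parabolic annulus.** If `u` is Type-I ancient mild with the quarter-rate dissipation law and
singular at the apex, there are `N > 1` and `δ > 0` such that for EVERY scale `l > 0` some point
`(t, x)` with `l²/N ≤ −t ≤ N l²`, `‖x‖ ≤ N l` has `√(−t) ‖u(t,x)‖ ≥ δ` (unwinding
`exists_piece_norm_ge_of_singular`: `t = l²s`, `x = l y`, `√(−t)‖u‖ = √(−s) · ‖u_l(s,y)‖`). -/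
theorem exists_scaleInvariant_amplitude_ge_of_singular {C K : ℝ}
    {u : ℝ → EuclideanSpace ℝ (Fin 3) → EuclideanSpace ℝ (Fin 3)} (hu : IsTypeIAncientMild C u)
    (hlaw : ∀ s : ℝ, s < 0 → ∫⁻ x, ‖fderiv ℝ (u s) x‖ₑ ^ 2 ≤ ENNReal.ofReal (K / Real.sqrt (-s)))
    (hsing : ∀ r > 0, ∀ M : ℝ, ∃ t ∈ Set.Ioo (-(r ^ 2)) (0 : ℝ),
      ∃ x ∈ Metric.ball (0 : EuclideanSpace ℝ (Fin 3)) r, M < ‖u t x‖) :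
    ∃ N : ℝ, 1 < N ∧ ∃ δ : ℝ, 0 < δ ∧ ∀ l : ℝ, 0 < l →
      ∃ (t : ℝ) (x : EuclideanSpace ℝ (Fin 3)),
        l ^ 2 / N ≤ -t ∧ -t ≤ N * l ^ 2 ∧ ‖x‖ ≤ N * l ∧ δ ≤ Real.sqrt (-t) * ‖u t x‖ := by
  obtain ⟨n, δ₀, hδ₀, h⟩ := exists_piece_norm_ge_of_singular hu hlaw hsing
  set N : ℝ := (n : ℝ) + 2 with hN
  have hN1 : 1 < N := by
    have : (0 : ℝ) ≤ n := Nat.cast_nonneg n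
    simp only [hN]; linarith
  have hN0 : 0 < N := by linarith
  refine ⟨N, hN1, δ₀ / Real.sqrt N, div_pos hδ₀ (Real.sqrt_pos.2 hN0), fun l hl => ?_⟩
  obtain ⟨z, hz, hδz⟩ := h l hl
  obtain ⟨⟨hz1, hz2⟩, hz3⟩ := mem_slabPiece.1 hz
  have hs0 : 0 < -z.1 := by
    have : (0 : ℝ) < 1 / N := by positivity
    simp only [hN] at this; linarith
  refine ⟨l ^ 2 * z.1, l • z.2, ?_, ?_, ?_, ?_⟩
  · -- `l²/N ≤ -(l² z.1)` from `z.1 ≤ -1/N`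
    rw [div_le_iff₀ hN0]
    have h1 : 1 / N ≤ -z.1 := by simp only [hN]; linarith
    have h2 : 1 ≤ -z.1 * N := by rwa [div_le_iff₀ hN0] at h1
    nlinarith [sq_nonneg l]
  · -- `-(l² z.1) ≤ N l²` from `-(n+2) ≤ z.1`
    have h1 : -z.1 ≤ N := by simp only [hN]; linarith
    nlinarith [sq_nonneg l]
  · rw [norm_smul, Real.norm_of_nonneg hl.le, mul_comm]
    exact mul_le_mul_of_nonneg_right hz3 hl.le
  · -- `√(-(l² s)) ‖u(l² s, l y)‖ = √(-s) · ‖u_l(s, y)‖ ≥ √(-s) δ₀ ≥ δ₀/√N`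
    have hsq : Real.sqrt (-(l ^ 2 * z.1)) = l * Real.sqrt (-z.1) := by
      rw [show -(l ^ 2 * z.1) = l ^ 2 * (-z.1) by ring, Real.sqrt_mul' _ hs0.le, Real.sqrt_sq hl.le]
    have hresc : ‖nsRescale l u z.1 z.2‖ = l * ‖u (l ^ 2 * z.1) (l • z.2)‖ := by
      rw [nsRescale_apply, norm_smul, Real.norm_of_nonneg hl.le]
    have hsN : 1 / Real.sqrt N ≤ Real.sqrt (-z.1) := by
      rw [div_le_iff₀ (Real.sqrt_pos.2 hN0), ← Real.sqrt_mul hs0.le]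
      have h1 : 1 / N ≤ -z.1 := by simp only [hN]; linarith
      have h2 : 1 ≤ -z.1 * N := by rwa [div_le_iff₀ hN0] at h1
      calc (1 : ℝ) = Real.sqrt 1 := Real.sqrt_one.symm
        _ ≤ Real.sqrt (-z.1 * N) := Real.sqrt_le_sqrt h2
    calc δ₀ / Real.sqrt N = (1 / Real.sqrt N) * δ₀ := by ring
      _ ≤ Real.sqrt (-z.1) * ‖nsRescale l u z.1 z.2‖ :=
          mul_le_mul hsN hδz hδ₀.le (Real.sqrt_nonneg _)
      _ = Real.sqrt (-(l ^ 2 * z.1)) * ‖u (l ^ 2 * z.1) (l • z.2)‖ := by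
          rw [hresc, hsq]; ring

end Summit.NavierStokesRegularity.NavierStokesRegularity.Theorems.FiniteDissipationLiouville.Nondegenerate

end
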